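/-
Copyright (c) 2026. All rights reserved.
Released under Apache 2.0 license as described in the file LICENSE.
Authors: abc-iut cell, statement-typer seat abc-iut-L4-t3 (wave 1; gen 6).
-/
import Literature.AnabelianGeometry.AbsoluteAnabelian.LogFrobeniusMonoTelecoreUnpinned
import Literature.AnabelianGeometry.AbsoluteAnabelian.LogFrobeniusMonoTelecorePinned
import Literature.AnabelianGeometry.AbsoluteAnabelian.LogFrobeniusMonoTelecoreOver
import HarnessLib

/-!
# [AbsTopIII] Corollary 5.10 (iv)(b)(c), interface add-on: the forgetful functors `ψ^{An⊢⊞}_{w,ν}` over `ℰ⊢` and the natural isomorphisms `η⊢_{v,ν}` over `ℰ⊢` (GAP-LEDGER G-f101-2 (c), (d))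

S. Mochizuki, *Topics in absolute anabelian geometry III: global reconstruction algorithms*,
J. Math. Sci. Univ. Tokyo 22 (2015) 939–1156 [MochizukiAbsTopIII2015]; locators `p.N` = pages of the author's
manuscript (`paper:url-5493eb38cbb7`), read on the page (own render): Prop 5.8 (vii) p. 141 l. 37–63 / p. 142 l. 1–24
("Write `An⊢[𝒩⊢⊞_w]` for the category whose objects consist of an object of `Th⊢[Z]`, together with the object of
`Orb(𝒞^{MLF⊢}_{TS⊞}[Γ⃗^×_non])` … given by applying the algorithm … to the object of `Orb(TG⊢)` obtained by projecting [at
`w`] the given object of `Th⊢[Z]`, and whose morphisms are the morphisms induced by `Th⊢[Z]`.  Thus we obtain a natural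
equivalence of categories `Th⊢[Z] ⥲ An⊢[𝒩⊢⊞_w]` together with a 'forgetful functor' `ψ^{An⊢⊞}_{w,ν} : An⊢[𝒩⊢⊞_w] → 𝒩⊢⊞_w`"),
Def 5.6 (iii)/(iv) pp. 135–136 (the 1-commutative mono-analyticization diagrams, "mono-analyticization homotopies"
Cor 5.10 preamble p. 146), Cor 5.10 (iv)(b)/(c) pp. 147–148 ("the restrictions `φ^{An⊢⊞}_{v,ν}` … give rise to a telecore
structure `𝔗_{An⊢}`"; "there is a natural isomorphism `η⊢_{v,ν}` from the composite functor determined by the path `γ¹_{v,ν}`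
… to the composite functor determined by the path `γ⁰_{v,ν}` … the resulting homotopies `η⊢_{v,ν}`, `(η⊢_{v,ν})⁻¹`,
together with the mono-analyticization homotopies … generate a contact structure `ℋ_{An⊢}` on `𝔗_{An⊢}` that is
compatible with the telecore … structures").

WHY THIS FILE (interface ADD-ON, successor never in place; the FROZEN `LogFrobeniusCompatibility.lean` is NOT edited;
GAP-LEDGER G-f101-2, owner = this lineage).  The interface `LogFrobeniusSetting` records the forgetful functors
`ψAnMono w ν` as BARE functors `An⊢[𝒩⊢⊞] → 𝒩⊢⊞_w` and does not record the printed `η⊢_{v,ν}` at all.  In print both carry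
structure: `ψ^{An⊢⊞}_{w,ν}` forgets to local data OF AN OBJECT OF `Th⊢[Z]` (Prop 5.8 (vii): objects of `An⊢[𝒩⊢⊞_w]` are
objects of `Th⊢[Z]` plus data; morphisms "induced by `Th⊢[Z]`") — so it lies over `ℰ⊢ = Th⊢[Z]` — and `η⊢_{v,ν}` is
"natural", a comparison of local data over ONE underlying theater — so it lies over `ℰ⊢` too.  abc-iut-f-101 proved in
the kernel that these data are exactly what Cor 5.10 (iv)(b)(c) needs: (iv)(b) the telecore `𝔗_{An⊢}` is CONSTRUCTED
from the rows-4→5 mono-analyticization homotopies (a) and "`ψ` lies over `ℰ⊢`" (c) (`monoTelecore hN hψ`,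
`LogFrobeniusMonoTelecoreOver.lean`), both NECESSARY (`toE_iso_of_cor510MonoTelecorePinned`,
`psiOverCore_iso_of_cor510MonoTelecorePinned`); (iv)(c) the contact structure needs the printed `η⊢_{v,ν}` (d)
(NECESSARY: `etaMono_iso_of_cor510MonoTelecorePinned`) TOGETHER WITH the coherence "`η⊢_{v,ν}` lies over `ℰ⊢`" (`hcoh` of
`LogFrobeniusMonoTelecoreFrameIsos.lean`: the one identity through which the compatibility of `ℋ_{An⊢}` with the
telecore family enters, `μ_monoE_app_lam`).  (a) and the rows-6→7 homotopy are this seat's add-on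
`MonoAnalyticizationHomotopies` (gen 5).  This file packages (c), (d) and the coherence, in abc-iut-f-101's binder shapes
VERBATIM, as ONE add-on over `M : L.MonoAnalyticizationHomotopies`:

* `MonoTelecoreCoherence L M` — fields `psiOver` (c), `eta` (d), `eta_over` (coherence: the image of `η⊢_{v,ν,y}` under
  `𝒩⊢⊞_v → 𝒩⊢_v → ℰ⊢`, followed by the mono-analyticization homotopies `𝒩⊞ → 𝒩⊢⊞ → 𝒩⊢ ≅ 𝒩⊞ → 𝒩 → 𝒩⊢` and (a) at `λ⊞_{v,ν}(y)`, is
  "`ψ` lies over `ℰ⊢`" at the core-image of `y` followed by the unit of `ℰ⊢ ≃ An⊢[𝒩⊢⊞]`);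
* `MonoTelecoreCoherence.monoTelecore` — **Cor 5.10 (iv)(b) over the add-on**: the telecore `𝔗_{An⊢}` of abc-iut-f-101,
  fed BY NAME with `M.toE` and `K.psiOver` (for `V(F_mod) ≠ ∅`);
* `MonoTelecoreCoherence.hN/hψ/hη/hcoh` — the four binders of abc-iut-f-101's sufficiency files, read off the add-on
  (so their final assembly `… → L.Cor510MonoTelecorePinned` — their R1–R3, HANDOFF 16:42Z — applies to `(M, K)` verbatim);
* necessity (by name, not restated): the pinned row forces inhabitants of the TYPES of `M.toE`, `K.psiOver`, `K.eta` —
  `printedData_of_cor510MonoTelecorePinned` (`LogFrobeniusMonoTelecorePinned.lean`); the coherence `eta_over` is a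
  condition on the CHOICE of these inhabitants, not forced in this form;
* non-vacuity: `taggedMonoTelecoreCoherence` — at abc-iut-f-101's TAGGED calibration setting (every printed datum present)
  the add-on is inhabited by identity isomorphisms and the coherence holds (all five morphisms are identities) — a
  DEGENERATE consistency witness; there the UNPINNED typed row F-0139 fails (`not_cor510MonoTelecore_tagged`) while its
  data (a)(c)(d)+coherence are all present.

ASSUMPTION-FREE typing of printed DATA plus one coherence the print carries implicitly ("natural", "compatible");
consumed as hypotheses at named settings.  Refereed pre-IUT material; nothing here bears on [IUTchIII] Cor. 3.12; OUR
kernel typing, no side taken; typed ≠ proved.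
-/

set_option autoImplicit false

universe u

open CategoryTheory

namespace Literature.AnabelianGeometry.AbsoluteAnabelian

namespace LogFrobeniusSetting

variable {Vmod : Type u} {isArc : Vmod → Bool} (L : LogFrobeniusSetting Vmod isArc)

/-! ## The add-on -/

/-- **INTERFACE ADD-ON (Prop 5.8 (vii) / Cor 5.10 (iv)(b)(c); GAP-LEDGER G-f101-2 (c), (d)).**  Over a setting `L` with
its mono-analyticization homotopies `M` (rows 4→5 `M.toE`, rows 6→7 `M.anToE`):
* `psiOver w ν` — "`ψ^{An⊢⊞}_{w,ν}` lies over `ℰ⊢`": the forgetful functor followed by `𝒩⊢⊞_w → 𝒩⊢_w → ℰ⊢` is the inverse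
  equivalence `An⊢[𝒩⊢⊞] ⥲ ℰ⊢` (Prop 5.8 (vii): `ψ` forgets to the local data of an object of `Th⊢[Z]`, morphisms "induced
  by `Th⊢[Z]`");
* `eta v ν hν` — the natural isomorphism `η⊢_{v,ν}` of Cor 5.10 (iv)(c) between the functors of
  `γ¹_{v,ν} = 𝒳 →(λ⊞_{v,ν}) 𝒩⊞_v → 𝒩_v → ℰ• → ℰ⊢ → An⊢[𝒩⊢⊞] →(φ^{An⊢⊞}_{v,ν}) 𝒩⊢⊞_v` and of `γ⁰_{v,ν} = 𝒳 →(λ⊞_{v,ν}) 𝒩⊞_v → 𝒩⊢⊞_v`,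
  for `ν ∈ Γ⃗^×_v`;
* `eta_over` — "`η⊢_{v,ν}` lies over `ℰ⊢`" (the coherence print carries in "natural … compatible"; abc-iut-f-101's
  `hcoh` verbatim): at every `y`, the image of `η⊢_{v,ν,y}` under `𝒩⊢⊞_v → 𝒩⊢_v → ℰ⊢`, then the rows-3→4 homotopy at
  `λ⊞_{v,ν}(y)`, then the rows-4→5 homotopy at `λ_{v,ν}(y)`, equals "`ψ` lies over `ℰ⊢`" at the image of `y` in
  `An⊢[𝒩⊢⊞]` followed by the unit of `ℰ⊢ ≃ An⊢[𝒩⊢⊞]`.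
[cite: MochizukiAbsTopIII2015, Cor 5.10 (iv)(c) p. 148] -/
structure MonoTelecoreCoherence (M : L.MonoAnalyticizationHomotopies) : Type (u + 1) where
  /-- (c) "`ψ^{An⊢⊞}_{w,ν}` lies over `ℰ⊢`" (Prop 5.8 (vii)). -/
  psiOver : ∀ (w : Vmod) (j : {ν : LogVertex (isArc w) // ν.IsCross}),
    L.ψAnMono w j ⋙ L.forgetMono w ⋙ L.toEmono w ≅ L.κAnMono.inverse
  /-- (d) the natural isomorphism `η⊢_{v,ν}` (Cor 5.10 (iv)(c)). -/
  eta : ∀ (v : Vmod) (ν : LogVertex (isArc v)) (hν : ν.IsCross),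
    L.lam v ν ⋙ L.forget v ⋙ L.toE v ⋙ L.monoAn ⋙ L.κAnMono.functor ⋙ L.ψAnMono v ⟨ν, hν⟩ ≅ L.lam v ν ⋙ L.monoNplus v
  /-- "`η⊢_{v,ν}` lies over `ℰ⊢`" (coherence with (a) and (c)). -/
  eta_over : ∀ (v : Vmod) (ν : LogVertex (isArc v)) (hν : ν.IsCross) (y : L.X),
    (L.toEmono v).map ((L.forgetMono v).map ((eta v ν hν).hom.app y)) ≫
        (L.toEmono v).map ((L.monoHomotopy v).hom.app ((L.lam v ν).obj y)) ≫
          (M.toE v).hom.app ((L.forget v).obj ((L.lam v ν).obj y)) =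
      (psiOver v ⟨ν, hν⟩).hom.app ((L.lam v ν ⋙ L.forget v ⋙ L.toE v ⋙ L.monoAn ⋙ L.κAnMono.functor).obj y) ≫
        L.κAnMono.unitIso.inv.app ((L.lam v ν ⋙ L.forget v ⋙ L.toE v ⋙ L.monoAn).obj y)

namespace MonoTelecoreCoherence

variable {L} {M : L.MonoAnalyticizationHomotopies} (K : L.MonoTelecoreCoherence M)

/-! ## The four binders of abc-iut-f-101's sufficiency files, read off the add-on -/

/-- binder `hN` (rows-4→5 mono-analyticization homotopies, Def 5.6 (iv)) = `M.toE`.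
[cite: MochizukiAbsTopIII2015, Cor 5.10 p. 146] -/
def hN (_K : L.MonoTelecoreCoherence M) : ∀ v : Vmod, L.monoN v ⋙ L.toEmono v ≅ L.toE v ⋙ L.monoAn := M.toE

/-- binder `hψ` ("`ψ` lies over `ℰ⊢`", Prop 5.8 (vii)) = `K.psiOver`. [cite: MochizukiAbsTopIII2015, Prop 5.8 (vii) p. 141] -/
def hψ : ∀ (w : Vmod) (j : {ν : LogVertex (isArc w) // ν.IsCross}),
    L.ψAnMono w j ⋙ L.forgetMono w ⋙ L.toEmono w ≅ L.κAnMono.inverse := K.psiOver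

/-- binder `hη` (the printed `η⊢_{v,ν}`, Cor 5.10 (iv)(c)) = `K.eta`. [cite: MochizukiAbsTopIII2015, Cor 5.10 (iv)(c) p. 148] -/
def hη : ∀ (v : Vmod) (ν : LogVertex (isArc v)) (hν : ν.IsCross),
    L.lam v ν ⋙ L.forget v ⋙ L.toE v ⋙ L.monoAn ⋙ L.κAnMono.functor ⋙ L.ψAnMono v ⟨ν, hν⟩ ≅ L.lam v ν ⋙ L.monoNplus v :=
  K.eta

/-- binder `hcoh` ("`η⊢` lies over `ℰ⊢`") = `K.eta_over`. [cite: MochizukiAbsTopIII2015, Cor 5.10 (iv)(c) p. 148] -/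
theorem hcoh : ∀ (v : Vmod) (ν : LogVertex (isArc v)) (hν : ν.IsCross) (y : L.X),
    (L.toEmono v).map ((L.forgetMono v).map ((K.hη v ν hν).hom.app y)) ≫
        (L.toEmono v).map ((L.monoHomotopy v).hom.app ((L.lam v ν).obj y)) ≫
          (K.hN v).hom.app ((L.forget v).obj ((L.lam v ν).obj y)) =
      (K.hψ v ⟨ν, hν⟩).hom.app ((L.lam v ν ⋙ L.forget v ⋙ L.toE v ⋙ L.monoAn ⋙ L.κAnMono.functor).obj y) ≫
        L.κAnMono.unitIso.inv.app ((L.lam v ν ⋙ L.forget v ⋙ L.toE v ⋙ L.monoAn).obj y) :=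
  K.eta_over

/-! ## Cor 5.10 (iv)(b) over the add-on -/

/-- **Cor 5.10 (iv)(b) over the add-on data**: the mono-analytic telecore `𝔗_{An⊢}` over the core `An⊢[𝒩⊢⊞]` of
`D•⊢_{≤5} ∪ D•_{≤6}`, with telecore edges the `φ^{An⊢⊞}_{w,ν}` — abc-iut-f-101's construction `monoTelecore` fed BY NAME
with the rows-4→5 homotopies `M.toE` and "`ψ` lies over `ℰ⊢`" `K.psiOver`, for every setting with `V(F_mod) ≠ ∅`.
[cite: MochizukiAbsTopIII2015, Cor 5.10 (iv)(b) p. 147] -/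
noncomputable def monoTelecore [Nonempty Vmod] :
    (L.subdiagram (monoBase 6)).Telecore (L.monoCoreObs M.toE) (L.monoCoreObs_isCore M.toE) :=
  L.monoTelecore M.toE K.psiOver

/-- Its telecore edges are the printed ones (`MonoTelecoreIdx`), definitionally — so `pinnedEdge` computes
(`pinnedEdge_rfl`) in any assembly of `Cor510MonoTelecorePinned` over it. [cite: MochizukiAbsTopIII2015, Cor 5.10 (iv)(b) p. 147] -/
theorem monoTelecore_J [Nonempty Vmod] : K.monoTelecore.J = fun a => MonoTelecoreIdx a.1 := rfl

end MonoTelecoreCoherence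

/-! ## Non-vacuity: the tagged calibration setting -/

variable (Vmod isArc)

/-- **The add-on is inhabited at abc-iut-f-101's TAGGED setting** (`𝒩⊞_v = 𝒩⊢⊞_v := C × Fin 2`,
`λ⊞_{v,ν} = ψ^{An⊢⊞}_{v,ν} := (𝟭, tag ν)`, every other structure functor `𝟭`, every 2-cell an identity): `ψ` lies over `ℰ⊢` and
`η⊢_{v,ν}` exists BY IDENTITIES (`tagged_psiOver`, `tagged_etaPinned`), and the coherence holds because all five morphisms in
it are identities of the same object of `C`.  DEGENERATE consistency witness; at this setting the UNPINNED typed row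
F-0139 FAILS (`not_cor510MonoTelecore_tagged`) although (a)(c)(d)+coherence are all present.
[cite: MochizukiAbsTopIII2015, Cor 5.10 (iv)(c) p. 148] -/
def taggedMonoTelecoreCoherence (C : Type (u + 1)) [Category.{u} C] :
    (tagged Vmod isArc C).MonoTelecoreCoherence (taggedMonoHomotopies Vmod isArc C) where
  psiOver := fun _ _ => Iso.refl _
  eta := fun _ _ _ => Iso.refl _
  eta_over := fun v ν hν y => by
    change (𝟙 y ≫ 𝟙 y ≫ 𝟙 y : y ⟶ y) = 𝟙 y ≫ 𝟙 y
    simp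

/-- Hence, over every index set: a setting carrying `MonoAnalyticizationHomotopies` AND `MonoTelecoreCoherence` at which
`Cor510MonoCores` holds (for `V(F_mod) ≠ ∅`) and the UNPINNED `Cor510MonoTelecore` fails (given a nonarchimedean place) —
the add-on does not resurrect the over-strong typed row. [cite: MochizukiAbsTopIII2015, Cor 5.10 (iv)(c) p. 148] -/
theorem exists_monoTelecoreCoherence_not_cor510MonoTelecore (v₀ : Vmod) (hv₀ : isArc v₀ = false) :
    ∃ (L : LogFrobeniusSetting Vmod isArc) (M : L.MonoAnalyticizationHomotopies),
      Nonempty (L.MonoTelecoreCoherence M) ∧ L.Cor510MonoCores ∧ ¬ L.Cor510MonoTelecore := by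
  haveI : Nonempty Vmod := ⟨v₀⟩
  exact ⟨tagged Vmod isArc (Type u), taggedMonoHomotopies Vmod isArc (Type u),
    ⟨taggedMonoTelecoreCoherence Vmod isArc (Type u)⟩, tagged_cor510MonoCores Vmod isArc (Type u),
    not_cor510MonoTelecore_tagged Vmod isArc (Type u) PUnit v₀ hv₀⟩

end LogFrobeniusSetting

end Literature.AnabelianGeometry.AbsoluteAnabelian
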